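import Summits.BirchSwinnertonDyer.Rank1Residual.GaloisImage.KolyvaginSystemOfEulerSystemPair
import Summits.BirchSwinnertonDyer.Rank1Residual.GaloisImage.KolyvaginSystemOfEulerSystemBadPlaces
import HarnessLib

/-!
# THEOREM D at two depths with (COMP) for `𝓕_can`, the local clause at the ANOMALOUS bad places
# DISPLAYED as a named hypothesis (`hloc`, `hloc₂` — the class-level statement of [Ru00] Thm. 4.5.1
# read for the tree's tame derivative classes)
# (cell `bsd-addord`, seat w2-acc4 gen 0; route W2 `KimAtThreeKolyvagin`, crux 19560
# `KatoKuriharaPortThreeShared`, residual (C3) = the rows with an anomalous bad place — kernel side)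

n1011-p11's D7 `Derivative.Rat.exists_isKolyvaginSystem_pair_propagatedSelmerStructure` turns an Euler
system `c` of `T_pE` on the cyclotomic levels into Kolyvagin systems for Mazur–Rubin's
`𝓕_can = propagatedSelmerStructure W p k` / `… W p m` at two depths `k ≤ m`, compatible under
`x ↦ p^{m−k}x`, on the rows with `E(ℚ_w)[p] = 0` at EVERY bad `w ≠ p` (`hbad`); n1011-p15's D7-b
`…_of_primes''` replaces `hbad` by the prime thinning `p ∤ ord(w mod q)` (`𝒫″`).  THIS FILE proves the
same END with `hbad` replaced by the DISPLAYED local clause itself at the anomalous bad places, in the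
exact token shape of n1011-p15's single-place lemma
`Rat.localization_mem_propagatedSelmerStructure_of_res_eq_deriv_of_not_dvd_orderOf` WITH ITS ORDER
HYPOTHESIS DELETED:

* `hloc` (depth `k`, coefficient quotient `(T′, red, e)`): for every global transport `Ψ` computed on
  cocycles by `e`, every generator family `σ` (`σ_ℓ ∈ I_ℓ`, `χ_ℓ(σ_ℓ) = η_ℓ`), every level `r ⊆ 𝒫(D)`
  and every class `κ ∈ H¹_cont(Γ_ℚ, T′)` with `res_{U_r} κ = D_r (red_* c_{⊥,r})` (the descended
  Kolyvagin derivative class of level `r`), at every bad `w ≠ p`, `w ∉ r`, carrying a non-zero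
  `p`-torsion point over `ℚ_w`: `loc_w (Ψ κ) ∈ propagatedSelmerStructure W p k (inr w)`;
* `hloc₂`: the same at depth `m` for `(T″, red″, e″)`.

This is the statement of [Ru00] Thm. 4.5.1 (`(κ_{[ℚ,r,M]})_w ∈ H¹_f(ℚ_w, W_M)` for `w ∤ pr`; [MR04]
Prop. A.2) READ for the tree's derivative construction at the anomalous bad places of `E` — DISPLAYED,
not asserted: [MR04] Prop. A.2 (p. 80) states the `𝓕^{np}` condition for `{κ_n^{(k)} : n ∈ 𝒩_j}` "for
all sufficiently large `j`" (primes `≡ 1 (mod p^j)`), and the tree holds the matching mechanism only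
under a prime-to-`p` residue-degree hypothesis (n1011-p15 T-DER-BN `…_of_not_dvd_orderOf`,
`Rat.exists_map_red_eq_localization_of_layer`); for data containing a prime `q` whose residue degree at
`w` has a larger `p`-part than every layer `ℚ_i` with `q ≡ 1 (mod p^{i+1})` absorbs, NO published
argument gives the clause (seat memo C3-ANATOMY-w2acc4.md).  Proof = D7-b's assembly verbatim (D1, D2 at
both depths with ONE `σ`, GZ-1, D3b twice with the three-way split of the non-good places — `w ∣ p` →
`htop`; bad `w` with `E(ℚ_w)[p] = 0` → F10; ANOMALOUS bad `w` → `hloc`/`hloc₂` on the pulled-back class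
(C5b-β′) — and D6 for (COMP)).  No definition, no named fact, no `sorry`; closes nothing by itself.

References: K. Rubin, *Euler Systems* (2000) Def. 4.4.4, Thm. 4.5.1, §4.6; B. Mazur, K. Rubin, Mem.
AMS 799 (2004), Def. 3.2.1, Thm. 3.2.4, App. A Prop. A.2; C.-H. Kim, AJM 148 (2026) Thm. 3.13, §2.2.2.
-/

noncomputable section

set_option linter.dupNamespace false

open CategoryTheory Function Finset Polynomial Field IsDedekindDomain
open scoped NumberField Classical ContRepresentation
open Literature.NumberTheory.GaloisRepresentations Literature.NumberTheory.EllipticCurves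
open Literature.NumberTheory.GaloisRepresentations.DiscreteGaloisModule
open Literature.NumberTheory.GaloisCohomology
open Summit.BirchSwinnertonDyer.Rank1Residual.GaloisImage
open Summit.BirchSwinnertonDyer.Rank1Residual.GaloisImage.CoeffTransport
open Summit.BirchSwinnertonDyer.Rank1Residual.GaloisImage.CyclotomicLevel
open Summit.BirchSwinnertonDyer.Rank1Residual.GaloisImage.Derivative
open Summit.BirchSwinnertonDyer.Rank1Residual.GaloisImage.Derivative.Rat
open Rat.HeightOneSpectrum WeierstrassCurve TateModule

universe u

namespace Summit.BirchSwinnertonDyer.BirchSwinnertonDyer.Theorems.KimAtThreePortSharedC3Pair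

variable (W : WeierstrassCurve ℚ) [W.IsElliptic] [W.IsGloballyMinimal] (p : ℕ) [Fact p.Prime]
variable [Module.Free ℤ_[p] (W.tateModule p)] [Module.Finite ℤ_[p] (W.tateModule p)]
  [ContinuousSMul ℤ_[p] (W.tateModule p)]

/-- Local notation: `T∞ = T_p E` as a continuous `G_ℚ`-representation. -/
local notation3 "T∞" => WeierstrassCurve.tateGaloisRep W p (W.continuous_galoisRepTate_holds p)

/-- Local notation: `𝐫⟦f, T′, U⟧ = f_* : H¹(U, T_pE) → H¹(U, T′)`. -/
local notation3 (prettyPrint := false) "𝐫⟦" f ", " Tg ", " U "⟧" =>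
  ContinuousCohomology.map (ContinuousMonoidHom.id _)
    (X := subgroupRep (ContinuousRep.toTopRep T∞) U)
    (Y := subgroupRep (ContinuousRep.toTopRep Tg) U)
    ((TopRep.resFunctor (Subgroup.subtype U)).map f) 1

variable (S : Set (HeightOneSpectrum (𝓞 ℚ)))

/-- Local notation: `𝓛` = the cyclotomic Euler-system levels `ℚ(μ_{p^{n+1}}, μ_r)`, `r ∩ S = ∅`. -/
local notation3 "𝓛" => cyclotomicLevelsRat p S

/-- Local notation: `𝐃⟦A, X, U, τ⟧ ℓ = ∑_{j < ℓ−1} j·(τ_ℓ)_*^j`, Kolyvagin's derivative operator. -/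
local notation3 (prettyPrint := false) "𝐃⟦" A ", " X ", " U ", " τ "⟧" =>
  fun ℓ : HeightOneSpectrum (𝓞 ℚ) =>
  ∑ j ∈ Finset.range (((primesEquiv ℓ : Nat.Primes) : ℕ) - 1),
    (j : Module.End A (continuousCohomology 1 (subgroupRep X U))) *
      (conjMap X U ((τ : HeightOneSpectrum (𝓞 ℚ) → absoluteGaloisGroup ℚ) ℓ) 1).hom.toLinearMap ^ j

/-- **THEOREM D at TWO depths with (COMP), the local clause at the anomalous bad places DISPLAYED**
(`hloc`, `hloc₂`; module docstring): every binder of n1011-p11's D7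
`exists_isKolyvaginSystem_pair_propagatedSelmerStructure` with `hbad` replaced by `hloc` / `hloc₂`
([Ru00] Thm. 4.5.1 read for the tree's derivative classes of the Euler system `c` at depth `k` /
`m`, at the bad `w ≠ p` with `E(ℚ_w)[p] ≠ 0`; DISPLAYED, not asserted); `htop`, `htop″` at `p`
unchanged.  Conclusion identical to D7's: ONE `σ`, transports `Φ_r`, `Φ″_r`, the two families with
`D.IsKolyvaginSystem (𝓕_can,k) κ`, `D″.IsKolyvaginSystem (𝓕_can,m) κ″`, the derivative
characterisations, and `π_* (κ″ d) = κ d` on the common levels.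
[cite: MazurRubin2004, Def. 3.2.1, Thm. 3.2.4 and App. A (Prop. A.2, p. 80)]
[cite: Rubin2000, Def. 4.4.4, Thm. 4.5.1 and §4.6] [cite: Kim2022StructureSelmer, Thm. 3.13 and §2.2.2] -/
theorem exists_isKolyvaginSystem_pair_propagatedSelmerStructure_of_localCondition (hp2 : p ≠ 2)
    {k m : ℕ} (hkm : k ≤ m)
    {c : ∀ (i : ℕ) (r : (𝓛).Ideals), H1 T∞ ((𝓛).level i r.1)}
    (hc : IsEulerSystem 𝓛 T∞ p c)
    -- depth `k`
    {M' : Type} [AddCommGroup M'] [Module ℤ_[p] M'] [TopologicalSpace M'] [DiscreteTopology M']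
    [IsTopologicalAddGroup M'] [ContinuousSMul ℤ_[p] M'] {T' : GaloisRep ℚ ℤ_[p] M'}
    (red : T∞.toTopRep ⟶ T'.toTopRep) (hred : Function.Surjective red.hom)
    (hM : ∀ x : M', ((p : ℤ_[p]) ^ (k + 1)) • x = 0)
    (e : M' →+ WeierstrassCurve.geomTorsion W ((p : ℤ) ^ k * (p : ℤ))) (hec : Continuous e)
    (he : ∀ (g : absoluteGaloisGroup ℚ) (x : M'),
      e (T'.toTopRep.ρ g x) = (W.torsionGaloisModule ((p : ℤ) ^ k * (p : ℤ))).toTopRep.ρ g (e x))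
    (einv : WeierstrassCurve.geomTorsion W ((p : ℤ) ^ k * (p : ℤ)) →+ M') (hic : Continuous einv)
    (h₁ : ∀ x, einv (e x) = x) (h₂ : ∀ y, e (einv y) = y)
    (hcomp : ∀ a : W.tateModule p,
      ((e (red.hom a) : geomTorsion W ((p : ℤ) ^ k * (p : ℤ))) : geomPoints W) = proj p (k + 1) a)
    -- depth `m`
    {M'' : Type} [AddCommGroup M''] [Module ℤ_[p] M''] [TopologicalSpace M''] [DiscreteTopology M'']
    [IsTopologicalAddGroup M''] [ContinuousSMul ℤ_[p] M''] {T'' : GaloisRep ℚ ℤ_[p] M''}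
    (red'' : T∞.toTopRep ⟶ T''.toTopRep) (hred'' : Function.Surjective red''.hom)
    (hM'' : ∀ x : M'', ((p : ℤ_[p]) ^ (m + 1)) • x = 0)
    (e'' : M'' →+ WeierstrassCurve.geomTorsion W ((p : ℤ) ^ m * (p : ℤ))) (hec'' : Continuous e'')
    (he'' : ∀ (g : absoluteGaloisGroup ℚ) (x : M''),
      e'' (T''.toTopRep.ρ g x) = (W.torsionGaloisModule ((p : ℤ) ^ m * (p : ℤ))).toTopRep.ρ g (e'' x))
    (einv'' : WeierstrassCurve.geomTorsion W ((p : ℤ) ^ m * (p : ℤ)) →+ M'') (hic'' : Continuous einv'')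
    (h₁'' : ∀ x, einv'' (e'' x) = x) (h₂'' : ∀ y, e'' (einv'' y) = y)
    (hcomp'' : ∀ a : W.tateModule p,
      ((e'' (red''.hom a) : geomTorsion W ((p : ℤ) ^ m * (p : ℤ))) : geomPoints W) = proj p (m + 1) a)
    (π : (W.torsionGaloisModule ((p : ℤ) ^ m * (p : ℤ))).toContRepresentation →ⁱL
      (W.torsionGaloisModule ((p : ℤ) ^ k * (p : ℤ))).toContRepresentation)
    (hπ : ∀ x : geomTorsion W ((p : ℤ) ^ m * (p : ℤ)),
      ((π x : geomTorsion W ((p : ℤ) ^ k * (p : ℤ))) : geomPoints W) =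
        ((p : ℤ) ^ (m - k)) • (x : geomPoints W))
    -- the curve and the two datums (same primitive roots `η`)
    (hirr : W.HasIrreducibleModPGaloisRep p)
    (D : KolyvaginDatum (W.torsionGaloisModule ((p : ℤ) ^ k * (p : ℤ))))
    (hT : D.transverse = cyclotomicTransverse (W.torsionGaloisModule ((p : ℤ) ^ k * (p : ℤ))))
    (D'' : KolyvaginDatum (W.torsionGaloisModule ((p : ℤ) ^ m * (p : ℤ))))
    (hT'' : D''.transverse = cyclotomicTransverse (W.torsionGaloisModule ((p : ℤ) ^ m * (p : ℤ))))
    {η : (ℓ : HeightOneSpectrum (𝓞 ℚ)) → (ZMod (Ideal.absNorm ℓ.asIdeal))ˣ}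
    (hD : D.HasCanonicalComparison (p ^ (k + 1)) η) (hD'' : D''.HasCanonicalComparison (p ^ (m + 1)) η)
    (hPr : D.primes ⊆ (𝓛).primes) (hPr'' : D''.primes ⊆ (𝓛).primes)
    (hKol : ∀ ℓ ∈ D.primes, Kato.IsKolyvaginPrime W p (k + 1) ((primesEquiv ℓ : Nat.Primes) : ℕ))
    (hKol'' : ∀ ℓ ∈ D''.primes, Kato.IsKolyvaginPrime W p (m + 1) ((primesEquiv ℓ : Nat.Primes) : ℕ))
    -- the DISPLAYED local clause at the ANOMALOUS bad places ([Ru00] Thm. 4.5.1 read), depth `k`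
    (hloc : ∀ (Ψ : continuousCohomology 1 T'.toTopRep →+
        galoisCohomology (W.torsionGaloisModule ((p : ℤ) ^ k * (p : ℤ))) 1),
      (∀ (φ : contOneCocycles T'.toTopRep)
        (ψ : contOneCocycles (W.torsionGaloisModule ((p : ℤ) ^ k * (p : ℤ))).toTopRep),
        (∀ g, ψ.1 g = e (φ.1 g)) → Ψ (oneCocycleClass _ φ) = oneCocycleClass _ ψ) →
      ∀ (σ : HeightOneSpectrum (𝓞 ℚ) → absoluteGaloisGroup ℚ),
        (∀ ℓ, σ ℓ ∈ (adicCompletionPrime ℚ ℓ).inertia (absoluteGaloisGroup ℚ)) →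
        (∀ ℓ, modNCyclotomicCharacter ℚ (Ideal.absNorm ℓ.asIdeal) (σ ℓ) = η ℓ) →
      ∀ (r : (𝓛).Ideals), (↑r.1 : Set (HeightOneSpectrum (𝓞 ℚ))) ⊆ D.primes →
      ∀ (comm : ((r.1 : Finset _) : Set (HeightOneSpectrum (𝓞 ℚ))).Pairwise fun a b =>
          Commute (𝐃⟦ℤ_[p], T'.toTopRep, ((𝓛).level ⊥ r.1), σ⟧ a)
            (𝐃⟦ℤ_[p], T'.toTopRep, ((𝓛).level ⊥ r.1), σ⟧ b))
        (κ : continuousCohomology 1 T'.toTopRep),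
        resSubgroup T'.toTopRep ((𝓛).level ⊥ r.1) 1 κ =
          (r.1.noncommProd 𝐃⟦ℤ_[p], T'.toTopRep, ((𝓛).level ⊥ r.1), σ⟧ comm)
            (𝐫⟦red, T', ((𝓛).level ⊥ r.1)⟧ (c ⊥ r)) →
      ∀ w : HeightOneSpectrum (𝓞 ℚ), (∀ q ∈ r.1, q ≠ w) → ¬ W.HasGoodReductionAt w →
        ((primesEquiv w : Nat.Primes) : ℕ) ≠ p →
        (∃ P : (W.baseChange (w.adicCompletion ℚ)).toAffine.Point, p • P = 0 ∧ P ≠ 0) →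
        galoisCohomology.localization (W.torsionGaloisModule ((p : ℤ) ^ k * (p : ℤ))) (Sum.inr w) 1
          (Ψ κ) ∈ propagatedSelmerStructure W p k (Sum.inr w))
    -- the same at depth `m`
    (hloc₂ : ∀ (Ψ : continuousCohomology 1 T''.toTopRep →+
        galoisCohomology (W.torsionGaloisModule ((p : ℤ) ^ m * (p : ℤ))) 1),
      (∀ (φ : contOneCocycles T''.toTopRep)
        (ψ : contOneCocycles (W.torsionGaloisModule ((p : ℤ) ^ m * (p : ℤ))).toTopRep),
        (∀ g, ψ.1 g = e'' (φ.1 g)) → Ψ (oneCocycleClass _ φ) = oneCocycleClass _ ψ) →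
      ∀ (σ : HeightOneSpectrum (𝓞 ℚ) → absoluteGaloisGroup ℚ),
        (∀ ℓ, σ ℓ ∈ (adicCompletionPrime ℚ ℓ).inertia (absoluteGaloisGroup ℚ)) →
        (∀ ℓ, modNCyclotomicCharacter ℚ (Ideal.absNorm ℓ.asIdeal) (σ ℓ) = η ℓ) →
      ∀ (r : (𝓛).Ideals), (↑r.1 : Set (HeightOneSpectrum (𝓞 ℚ))) ⊆ D''.primes →
      ∀ (comm : ((r.1 : Finset _) : Set (HeightOneSpectrum (𝓞 ℚ))).Pairwise fun a b =>
          Commute (𝐃⟦ℤ_[p], T''.toTopRep, ((𝓛).level ⊥ r.1), σ⟧ a)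
            (𝐃⟦ℤ_[p], T''.toTopRep, ((𝓛).level ⊥ r.1), σ⟧ b))
        (κ : continuousCohomology 1 T''.toTopRep),
        resSubgroup T''.toTopRep ((𝓛).level ⊥ r.1) 1 κ =
          (r.1.noncommProd 𝐃⟦ℤ_[p], T''.toTopRep, ((𝓛).level ⊥ r.1), σ⟧ comm)
            (𝐫⟦red'', T'', ((𝓛).level ⊥ r.1)⟧ (c ⊥ r)) →
      ∀ w : HeightOneSpectrum (𝓞 ℚ), (∀ q ∈ r.1, q ≠ w) → ¬ W.HasGoodReductionAt w →
        ((primesEquiv w : Nat.Primes) : ℕ) ≠ p →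
        (∃ P : (W.baseChange (w.adicCompletion ℚ)).toAffine.Point, p • P = 0 ∧ P ≠ 0) →
        galoisCohomology.localization (W.torsionGaloisModule ((p : ℤ) ^ m * (p : ℤ))) (Sum.inr w) 1
          (Ψ κ) ∈ propagatedSelmerStructure W p m (Sum.inr w))
    (htop : ∀ w : HeightOneSpectrum (𝓞 ℚ), ((primesEquiv w : Nat.Primes) : ℕ) = p →
      propagatedSelmerStructure W p k (Sum.inr w) = ⊤)
    (htop'' : ∀ w : HeightOneSpectrum (𝓞 ℚ), ((primesEquiv w : Nat.Primes) : ℕ) = p →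
      propagatedSelmerStructure W p m (Sum.inr w) = ⊤) :
    ∃ (σ : HeightOneSpectrum (𝓞 ℚ) → absoluteGaloisGroup ℚ)
      (Φ : ∀ r : Finset (HeightOneSpectrum (𝓞 ℚ)),
        continuousCohomology 1 (subgroupRep T'.toTopRep ((𝓛).level ⊥ r)) →+
          continuousCohomology 1 (subgroupRep
            (W.torsionGaloisModule ((p : ℤ) ^ k * (p : ℤ))).toTopRep ((𝓛).level ⊥ r)))
      (comm : ∀ r : Finset (HeightOneSpectrum (𝓞 ℚ)),
        ((r : Finset _) : Set (HeightOneSpectrum (𝓞 ℚ))).Pairwise fun a b =>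
          Commute (𝐃⟦ℤ, (W.torsionGaloisModule ((p : ℤ) ^ k * (p : ℤ))).toTopRep, ((𝓛).level ⊥ r), σ⟧ a)
            (𝐃⟦ℤ, (W.torsionGaloisModule ((p : ℤ) ^ k * (p : ℤ))).toTopRep, ((𝓛).level ⊥ r), σ⟧ b))
      (κ : Finset (HeightOneSpectrum (𝓞 ℚ)) → galoisCohomology (W.torsionGaloisModule ((p : ℤ) ^ k * (p : ℤ))) 1)
      (Φ'' : ∀ r : Finset (HeightOneSpectrum (𝓞 ℚ)),
        continuousCohomology 1 (subgroupRep T''.toTopRep ((𝓛).level ⊥ r)) →+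
          continuousCohomology 1 (subgroupRep
            (W.torsionGaloisModule ((p : ℤ) ^ m * (p : ℤ))).toTopRep ((𝓛).level ⊥ r)))
      (comm'' : ∀ r : Finset (HeightOneSpectrum (𝓞 ℚ)),
        ((r : Finset _) : Set (HeightOneSpectrum (𝓞 ℚ))).Pairwise fun a b =>
          Commute (𝐃⟦ℤ, (W.torsionGaloisModule ((p : ℤ) ^ m * (p : ℤ))).toTopRep, ((𝓛).level ⊥ r), σ⟧ a)
            (𝐃⟦ℤ, (W.torsionGaloisModule ((p : ℤ) ^ m * (p : ℤ))).toTopRep, ((𝓛).level ⊥ r), σ⟧ b))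
      (κ'' : Finset (HeightOneSpectrum (𝓞 ℚ)) →
        galoisCohomology (W.torsionGaloisModule ((p : ℤ) ^ m * (p : ℤ))) 1),
      (∀ ℓ, σ ℓ ∈ (adicCompletionPrime ℚ ℓ).inertia (absoluteGaloisGroup ℚ)) ∧
      (∀ ℓ, modNCyclotomicCharacter ℚ (Ideal.absNorm ℓ.asIdeal) (σ ℓ) = η ℓ) ∧
      (∀ r, ∀ (φ : contOneCocycles (subgroupRep T'.toTopRep ((𝓛).level ⊥ r)))
        (ψ : contOneCocycles (subgroupRep
          (W.torsionGaloisModule ((p : ℤ) ^ k * (p : ℤ))).toTopRep ((𝓛).level ⊥ r))),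
        (∀ g, ψ.1 g = e (φ.1 g)) → Φ r (oneCocycleClass _ φ) = oneCocycleClass _ ψ) ∧
      (∀ r, ∀ (φ : contOneCocycles (subgroupRep T''.toTopRep ((𝓛).level ⊥ r)))
        (ψ : contOneCocycles (subgroupRep
          (W.torsionGaloisModule ((p : ℤ) ^ m * (p : ℤ))).toTopRep ((𝓛).level ⊥ r))),
        (∀ g, ψ.1 g = e'' (φ.1 g)) → Φ'' r (oneCocycleClass _ φ) = oneCocycleClass _ ψ) ∧
      D.IsKolyvaginSystem (propagatedSelmerStructure W p k) κ ∧
      D''.IsKolyvaginSystem (propagatedSelmerStructure W p m) κ'' ∧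
      (∀ r : Finset (HeightOneSpectrum (𝓞 ℚ)), ¬ (↑r : Set _) ⊆ D.primes → κ r = 0) ∧
      (∀ r : Finset (HeightOneSpectrum (𝓞 ℚ)), ¬ (↑r : Set _) ⊆ D''.primes → κ'' r = 0) ∧
      (∀ (r : Finset (HeightOneSpectrum (𝓞 ℚ))) (hr : (↑r : Set _) ⊆ D.primes),
        resSubgroup (W.torsionGaloisModule ((p : ℤ) ^ k * (p : ℤ))).toTopRep ((𝓛).level ⊥ r) 1 (κ r) =
          (r.noncommProd 𝐃⟦ℤ, (W.torsionGaloisModule ((p : ℤ) ^ k * (p : ℤ))).toTopRep, ((𝓛).level ⊥ r), σ⟧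
            (comm r)) (Φ r (𝐫⟦red, T', ((𝓛).level ⊥ r)⟧
              (c ⊥ ⟨r, fun _ hq => hPr (hr (Finset.mem_coe.2 hq))⟩)))) ∧
      (∀ (r : Finset (HeightOneSpectrum (𝓞 ℚ))) (hr : (↑r : Set _) ⊆ D''.primes),
        resSubgroup (W.torsionGaloisModule ((p : ℤ) ^ m * (p : ℤ))).toTopRep ((𝓛).level ⊥ r) 1 (κ'' r) =
          (r.noncommProd 𝐃⟦ℤ, (W.torsionGaloisModule ((p : ℤ) ^ m * (p : ℤ))).toTopRep, ((𝓛).level ⊥ r), σ⟧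
            (comm'' r)) (Φ'' r (𝐫⟦red'', T'', ((𝓛).level ⊥ r)⟧
              (c ⊥ ⟨r, fun _ hq => hPr'' (hr (Finset.mem_coe.2 hq))⟩)))) ∧
      ∀ d : Finset (HeightOneSpectrum (𝓞 ℚ)), (↑d : Set _) ⊆ D.primes → (↑d : Set _) ⊆ D''.primes →
        galoisCohomology.map π 1 (κ'' d) = κ d := by
  have hmk : (p : ℤ) ^ k * (p : ℤ) = ((p ^ (k + 1) : ℕ) : ℤ) := by push_cast; ring
  have hmm : (p : ℤ) ^ m * (p : ℤ) = ((p ^ (m + 1) : ℕ) : ℤ) := by push_cast; ring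
  -- ONE generator family for both datums (D1 on `𝒫 ∪ 𝒫″`)
  obtain ⟨σ, hσI, hσχ, -, hσ⟩ := CyclotomicLevel.Rat.exists_sigma_mem_inertia_adicCompletionPrime p S η
    (D.primes ∪ D''.primes) (fun ℓ hℓ => hℓ.elim (fun h => hD.zpowers_eq_top h)
      (fun h => hD''.zpowers_eq_top h))
  have hσk : ∀ r : Finset (HeightOneSpectrum (𝓞 ℚ)), (↑r : Set _) ⊆ D.primes → _ :=
    fun r hr => hσ r (hr.trans Set.subset_union_left)
  have hσm : ∀ r : Finset (HeightOneSpectrum (𝓞 ℚ)), (↑r : Set _) ⊆ D''.primes → _ :=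
    fun r hr => hσ r (hr.trans Set.subset_union_right)
  -- `h0` at both depths from `Irr(E[p])`
  have h0k : ∀ r : Finset (HeightOneSpectrum (𝓞 ℚ)), (↑r : Set _) ⊆ D.primes →
      ∀ P : WeierstrassCurve.geomTorsion W ((p : ℤ) ^ k * (p : ℤ)),
        (∀ u : (𝓛).level ⊥ r, (u : absoluteGaloisGroup ℚ) • P = P) → P = 0 :=
    fun r _ P hP => geomTorsion_eq_zero_of_fixed_level W p S hp2 hirr hmk ⊥ r P hP
  have h0m : ∀ r : Finset (HeightOneSpectrum (𝓞 ℚ)), (↑r : Set _) ⊆ D''.primes →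
      ∀ P : WeierstrassCurve.geomTorsion W ((p : ℤ) ^ m * (p : ℤ)),
        (∀ u : (𝓛).level ⊥ r, (u : absoluteGaloisGroup ℚ) • P = P) → P = 0 :=
    fun r _ P hP => geomTorsion_eq_zero_of_fixed_level W p S hp2 hirr hmm ⊥ r P hP
  -- the two families (D2), same `σ`
  obtain ⟨Φ, comm, hΦ, κ, hκ0, hκ⟩ := exists_derivativeFamily W p S hc red (Nat.succ_pos k) hM e hec he
    einv hic h₁ h₂ D.primes hPr hKol σ hσk h0k
  obtain ⟨Φ'', comm'', hΦ'', κ'', hκ0'', hκ''⟩ := exists_derivativeFamily W p S hc red'' (Nat.succ_pos m)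
    hM'' e'' hec'' he'' einv'' hic'' h₁'' h₂'' D''.primes hPr'' hKol'' σ hσm h0m
  -- the global transports (GZ-1), for the pull-back of the classes to `T′`, `T″`
  obtain ⟨Φ₀, hΦ₀⟩ := exists_addEquiv_oneCocycleClass T'.toTopRep
    (W.torsionGaloisModule ((p : ℤ) ^ k * (p : ℤ))).toTopRep e hec he einv hic h₁ h₂
  obtain ⟨Φ₀'', hΦ₀''⟩ := exists_addEquiv_oneCocycleClass T''.toTopRep
    (W.torsionGaloisModule ((p : ℤ) ^ m * (p : ℤ))).toTopRep e'' hec'' he'' einv'' hic'' h₁'' h₂''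
  -- the unramified clause for `𝓕_can` at both depths (as in D4)
  have hunr : ∀ (j : ℕ) (w : HeightOneSpectrum (𝓞 ℚ)), W.HasGoodReductionAt w →
      ((primesEquiv w : Nat.Primes) : ℕ) ≠ p →
        unramifiedSubgroup (GaloisRep.toLocal w (W.torsionGaloisModule ((p : ℤ) ^ j * (p : ℤ)))) 1 ≤
          propagatedSelmerStructure W p j (Sum.inr w) := fun j w hw hne =>
    (propagatedSelmerStructure_inr_eq_unramifiedSubgroup W p j
      (WeierstrassCurve.natCast_not_mem_asIdeal_of_primesEquiv_ne Fact.out hne) hw).ge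
  -- an anomalous bad place, read off the failure of the torsion certificate
  have hanom : ∀ w : HeightOneSpectrum (𝓞 ℚ),
      ¬ (∀ P : (W.baseChange (w.adicCompletion ℚ)).toAffine.Point, p • P = 0 → P = 0) →
        ∃ P : (W.baseChange (w.adicCompletion ℚ)).toAffine.Point, p • P = 0 ∧ P ≠ 0 := by
    intro w htors
    by_contra hcon
    exact htors fun P hP => by
      by_contra hP0
      exact hcon ⟨P, hP, hP0⟩
  refine ⟨σ, Φ, comm, κ, Φ'', comm'', κ'', hσI, hσχ, hΦ, hΦ'', ?_, ?_, hκ0, hκ0'',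
    fun r hr => (hκ r hr).1, fun r hr => (hκ'' r hr).1, fun d hdk hdm => ?_⟩
  · -- depth `k`: THEOREM D-core (D3b); the non-good places by the three-way split
    refine isKolyvaginSystem_derivativeFamily_of_transverse_eq W p S hp2 hc red hred (Nat.succ_pos k) hM
      hmk e hec he einv hic h₁ h₂ D hT hD hPr hKol σ (fun ℓ _ => hσI ℓ) (fun ℓ _ => hσχ ℓ) hσk h0k Φ
      hΦ comm κ hκ0 (fun r hr => (hκ r hr).1) _ (hunr k) fun d hd w hwd hw => ?_
    by_cases hwp : ((primesEquiv w : Nat.Primes) : ℕ) = p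
    · rw [htop w hwp]
      exact AddSubgroup.mem_top _
    have hbad : ¬ W.HasGoodReductionAt w := fun hgood => hw ⟨hgood, hwp⟩
    by_cases htors : ∀ P : (W.baseChange (w.adicCompletion ℚ)).toAffine.Point, p • P = 0 → P = 0
    · rw [propagatedSelmerStructure_inr_eq_top_of_torsion_eq_zero W p k
        (WeierstrassCurve.natCast_not_mem_asIdeal_of_primesEquiv_ne Fact.out hwp) htors]
      exact AddSubgroup.mem_top _
    · -- an ANOMALOUS bad place: the displayed clause `hloc` on the pulled-back class (C5b-β′)
      have hwd' : ∀ q ∈ d, q ≠ w := fun q hq hqw => hwd (hqw ▸ hq)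
      have hκX := resSubgroup_symm_eq_noncommProd_deriv T'.toTopRep
        (W.torsionGaloisModule ((p : ℤ) ^ k * (p : ℤ))).toTopRep e hec he einv h₁ h₂ ((𝓛).level ⊥ d)
        Φ₀ hΦ₀ (Φ d) (hΦ d) σ _ d
        (pairwise_commute_deriv (L := 𝓛) (T' := T') ⊥ d σ
          (fun ℓ => ((primesEquiv ℓ : Nat.Primes) : ℕ) - 1)) (comm d) _ (κ d) ((hκ d hd).1)
      rw [← Φ₀.apply_symm_apply (κ d)]
      exact hloc Φ₀.toAddMonoidHom (fun φ ψ h => hΦ₀ φ ψ h) σ hσI hσχ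
        ⟨d, fun _ hq => hPr (hd (Finset.mem_coe.2 hq))⟩ hd _ (Φ₀.symm (κ d)) hκX w hwd' hbad hwp
        (hanom w htors)
  · -- depth `m`: the same
    refine isKolyvaginSystem_derivativeFamily_of_transverse_eq W p S hp2 hc red'' hred'' (Nat.succ_pos m)
      hM'' hmm e'' hec'' he'' einv'' hic'' h₁'' h₂'' D'' hT'' hD'' hPr'' hKol'' σ (fun ℓ _ => hσI ℓ)
      (fun ℓ _ => hσχ ℓ) hσm h0m Φ'' hΦ'' comm'' κ'' hκ0'' (fun r hr => (hκ'' r hr).1) _ (hunr m)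
      fun d hd w hwd hw => ?_
    by_cases hwp : ((primesEquiv w : Nat.Primes) : ℕ) = p
    · rw [htop'' w hwp]
      exact AddSubgroup.mem_top _
    have hbad : ¬ W.HasGoodReductionAt w := fun hgood => hw ⟨hgood, hwp⟩
    by_cases htors : ∀ P : (W.baseChange (w.adicCompletion ℚ)).toAffine.Point, p • P = 0 → P = 0
    · rw [propagatedSelmerStructure_inr_eq_top_of_torsion_eq_zero W p m
        (WeierstrassCurve.natCast_not_mem_asIdeal_of_primesEquiv_ne Fact.out hwp) htors]
      exact AddSubgroup.mem_top _
    · have hwd' : ∀ q ∈ d, q ≠ w := fun q hq hqw => hwd (hqw ▸ hq)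
      have hκX := resSubgroup_symm_eq_noncommProd_deriv T''.toTopRep
        (W.torsionGaloisModule ((p : ℤ) ^ m * (p : ℤ))).toTopRep e'' hec'' he'' einv'' h₁'' h₂''
        ((𝓛).level ⊥ d) Φ₀'' hΦ₀'' (Φ'' d) (hΦ'' d) σ _ d
        (pairwise_commute_deriv (L := 𝓛) (T' := T'') ⊥ d σ
          (fun ℓ => ((primesEquiv ℓ : Nat.Primes) : ℕ) - 1)) (comm'' d) _ (κ'' d) ((hκ'' d hd).1)
      rw [← Φ₀''.apply_symm_apply (κ'' d)]
      exact hloc₂ Φ₀''.toAddMonoidHom (fun φ ψ h => hΦ₀'' φ ψ h) σ hσI hσχ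
        ⟨d, fun _ hq => hPr'' (hd (Finset.mem_coe.2 hq))⟩ hd _ (Φ₀''.symm (κ'' d)) hκX w hwd' hbad hwp
        (hanom w htors)
  · -- (COMP) on the common levels
    exact map_derivativeFamily_eq W p S hkm red e hcomp red'' e'' hcomp'' π hπ (D.primes ∩ D''.primes)
      (fun ℓ hℓ => hPr hℓ.1) σ Φ hΦ comm κ (fun r hr => hκ r (hr.trans Set.inter_subset_left)) Φ'' hΦ''
      comm'' κ'' (fun r hr => (hκ'' r (hr.trans Set.inter_subset_right)).1) d
      (Set.subset_inter hdk hdm)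

end Summit.BirchSwinnertonDyer.BirchSwinnertonDyer.Theorems.KimAtThreePortSharedC3Pair

end
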